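import Mathlib
import Literature.Geometry.Symplectic.JHolomorphicMap
import Summits.SmoothPoincare4.SmoothPoincare4.Theorems.SullivanDualTameOrBrodyR4PencilDefs
import Summits.SmoothPoincare4.SmoothPoincare4.Theorems.SullivanDualTameOrBrodyR4HelperImmersionLocallyInjective
import Summits.SmoothPoincare4.SmoothPoincare4.Theorems.SullivanDualTameOrBrodyR4HelperPairDichotomy
import Summits.SmoothPoincare4.SmoothPoincare4.Theorems.SullivanDualTameOrBrodyR4HelperPairCoincide
import Summits.SmoothPoincare4.SmoothPoincare4.Theorems.SullivanDualTameOrBrodyR4HelperInjectiveOfCoincidenceStructure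

/-!
# Immersed limits of members are embedded (crux `TameOrBrodyR4`, stmt-SmoothPoincare4-7826, line `Sketch`, skeleton v16 — reshape #3, lead prover file)

Route `SullivanDual`, crux `Summit.SmoothPoincare4.SmoothPoincare4.Theses.SullivanDual.TameOrBrodyR4`.
The deep input `HasEmbeddedLimits` of the line (a `C¹_loc`-limit of members having every member
property except embeddedness IS embedded — adjunction for `A`-spheres) is cut in two: the
IMMERSION half stays deep (no cusps form in the limit: the local δ-invariant of a cusp), the
INJECTIVITY half is soft and proved here:

* `helper_injectiveOfImmersedLimit`: an immersed `J`-holomorphic plane `v`, normalised at infinity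
  (`P ∘ v − id → 0`), injective over the far lines, which is a `C¹_loc`-limit of INJECTIVE smooth
  curves, is injective. Proof: at a double point the two sheets either coincide near the second
  parameter through a continuous reparametrisation onto the first, or meet in an isolated point
  of non-zero index (`helper_pairIsolatedOrCoincide`: adapted coordinates along the first sheet,
  `|∂̄c| ≤ M|c|` for the normal coordinate of the second, local similarity principle); the isolated
  case would force the injective approximants to self-intersect (`helper_pairCoincideOfApprox`:
  quantitative inverse function theorem + winding persistence); and the coincidence set is clopen,
  nonempty at a double point, hence everything — contradicting injectivity over the far lines
  (`helper_injectiveOfCoincidenceStructure`; local injectivity from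
  `helper_immersionLocallyInjective`).
* `helper_embeddedLimitsOfImmersed` (registered): `HasEmbeddedLimits J R P Q` from the weaker input
  that limits of members are IMMERSED (the ∀-closed signature of the reshaped deep stub
  `stub_immersedLimits` of skeleton v16, instantiated at `(J, R, P, Q)`).

References: D. McDuff, *The local behaviour of holomorphic curves in almost complex 4-manifolds*,
J. Diff. Geom. 34 (1991); M. Micallef, B. White, Ann. of Math. 141 (1995); D. McDuff, D. Salamon,
*J-holomorphic curves and symplectic topology* (2012), §2.4, App. E (intersections of J-curves via
the Carleman similarity principle).
-/

-- the registered namespace `Summit.SmoothPoincare4.SmoothPoincare4.…` repeats a component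
set_option linter.dupNamespace false

noncomputable section

open scoped ContDiff Topology
open Filter Set Metric Literature.Geometry.Symplectic

namespace Summit.SmoothPoincare4.SmoothPoincare4.Cruxes.TameOrBrodyR4.Sketch

/-- Local notation for the model space `ℝ⁴ = EuclideanSpace ℝ (Fin 4)`. -/
local notation "E4" => EuclideanSpace ℝ (Fin 4)

/-- **An immersed limit of injective curves is injective.** Let `v : ℂ → ℝ⁴` be a `C^∞` immersed
`J`-holomorphic plane with `P (v ξ) - ξ → 0` at infinity and unique crossings of the far lines
`{P = c}`, `|c| > 2R`, and let `v` be the `C¹_loc`-limit of injective `C^∞` curves `u n`. Then `v`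
is injective. -/
theorem helper_injectiveOfImmersedLimit (J : E4 → E4 →L[ℝ] E4) (hJs : ContDiff ℝ ∞ J)
    (hJ2 : ∀ x v, J x (J x v) = -v) (P : E4 →L[ℝ] ℂ) (R : ℝ)
    (u : ℕ → ℂ → E4) (v : ℂ → E4)
    (hu : ∀ n, ContDiff ℝ ∞ (u n)) (huinj : ∀ n, Function.Injective (u n))
    (hv : ContDiff ℝ ∞ v) (hvJ : IsJHolomorphicFlat J v)
    (himm : ∀ ξ : ℂ, Function.Injective (fderiv ℝ v ξ))
    (hloc : TendstoLocallyUniformly u v atTop)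
    (hdloc : TendstoLocallyUniformly (fun n => fderiv ℝ (u n)) (fderiv ℝ v) atTop)
    (hprop : Tendsto (fun ξ => P (v ξ) - ξ) (cocompact ℂ) (𝓝 0))
    (hfar : ∀ c : ℂ, 2 * R < ‖c‖ → ∃! ξ, P (v ξ) = c) :
    Function.Injective v :=
  helper_injectiveOfCoincidenceStructure v hv.continuous P R hprop hfar
    (fun ξ => helper_immersionLocallyInjective v ξ hv (himm ξ))
    (helper_pairIsolatedOrCoincide J hJs hJ2 v hv hvJ himm)
    (helper_pairCoincideOfApprox J hJs hJ2 v hv hvJ himm u hu huinj hloc hdloc)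

/-- **Registered helper `helper_embeddedLimitsOfImmersed` (reshape #3 of the line skeleton):
`HasEmbeddedLimits` from immersed limits.** If every `C¹_loc`-limit of members (with the member
properties at infinity) is IMMERSED — the hypothesis `hIL`, verbatim the reshaped deep stub
`stub_immersedLimits` at `(J, R, P, Q)` — then it is also injective, i.e. `HasEmbeddedLimits J R P Q`. -/
theorem helper_embeddedLimitsOfImmersed (J : E4 → E4 →L[ℝ] E4) (R : ℝ) (P Q : E4 →L[ℝ] ℂ)
    (hJs : ContDiff ℝ ∞ J) (hJ2 : ∀ x v, J x (J x v) = -v)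
    (hIL : ∀ (b : ℕ → ℂ) (u : ℕ → ℂ → E4) (bs : ℂ) (v : ℂ → E4),
      (∀ n, IsPencilMember J R P Q (b n) (u n)) → Tendsto b atTop (𝓝 bs) →
      ContDiff ℝ ∞ v → IsJHolomorphicFlat J v →
      TendstoLocallyUniformly u v atTop →
      TendstoLocallyUniformly (fun n => fderiv ℝ (u n)) (fderiv ℝ v) atTop →
      Tendsto (fun ξ => Q (v ξ)) (cocompact ℂ) (𝓝 bs) →
      Tendsto (fun ξ => P (v ξ) - ξ) (cocompact ℂ) (𝓝 0) →
      (∀ c : ℂ, 2 * R < ‖c‖ → ∃! ξ, P (v ξ) = c) →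
      (∀ ξ : ℂ, 2 * R < ‖P (v ξ)‖ → Function.Bijective (fderiv ℝ (fun ξ => P (v ξ)) ξ)) →
      ∀ ξ : ℂ, Function.Injective (fderiv ℝ v ξ)) :
    HasEmbeddedLimits J R P Q := by
  intro b u bs v hm hb hv hvJ hloc hdloc hQ hP h7 h8
  have himm : ∀ ξ : ℂ, Function.Injective (fderiv ℝ v ξ) :=
    hIL b u bs v hm hb hv hvJ hloc hdloc hQ hP h7 h8
  refine ⟨?_, himm⟩
  exact helper_injectiveOfImmersedLimit J hJs hJ2 P R u v (fun n => (hm n).1)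
    (fun n => (hm n).2.2.1) hv hvJ himm hloc hdloc hP h7

end Summit.SmoothPoincare4.SmoothPoincare4.Cruxes.TameOrBrodyR4.Sketch
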